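import Summits.AtomisticToContinuum.HydrodynamicLimit.Theorems.JParityClosureParityBandClosureWindowCovarianceIsotropyJ
import HarnessLib

/-!
# Window covariance isotropy (crux `JParityClosure.ParityBandClosure`, stmt-AtomisticToContinuum-17608, line
# `transfer-weighted-parity-chain`, stub `stub_windowCovarianceIsotropy`) — helper K: the bound of ONE window

WHAT.  `window_bound`: for one window `(t₀, x₀)`, the cut-off-weighted deviator `g(σ³ρ_w) dev C_w` is at most
`18(ε+ε²) Gb ρ_w + 4 Gb T_w + 4V²[Gb ρ_min + ρ̄ g Σ_j|K^O_j|/η + ρ̄ Gb Σ_j (g₀σ³B_j − K^R_j)₊/η + ρ̄ Gb (κ_w(Q) + mom₂ κ_w)/M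
+ ρ̄ Gb mom₃ λ_w/(Mρ_min)]` (`ρ̄ = η₀/σ³`, `T_w` the window quadratic tail above `V`): GOOD windows by helper J
(`good_window`); OTHER windows by `dev ≤ 4∫‖v‖²dλ_w ≤ 4(V²ρ_w + T_w)`, the failed test paying for
`g(σ³ρ_w)ρ_w ≤ ρ̄ g(σ³ρ_w)` (the cut-off vanishes above `η₀`).

REFERENCES.  The line's card (lead NOTES).  No named fact is invoked.
-/

noncomputable section

namespace Summit.AtomisticToContinuum.HydrodynamicLimit.Theorems.ParityBandClosureWindowCovariance

open scoped BigOperators Topology Classical MeasureTheory ENNReal InnerProductSpace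
open Filter Set MeasureTheory Function Topology
open Literature.MathematicalPhysics.KineticTheory
open Literature.Analysis.FluidPDE
open Summit.AtomisticToContinuum.HydrodynamicLimit.Theorems.LocalSecondLawNegative (cone cone_nonneg cone_le
  continuous_cone integral_cone_le)
open Summit.AtomisticToContinuum.HydrodynamicLimit.Theorems.ChaosClosesEulerStressIsotropy (sqTail sqTail_nonneg
  measurable_sqTail norm_sq_le_add_sqTail)

variable {N : ℕ}

section Window

variable {ε r τ t₀ : ℝ} {x₀ : T3} {γ : ℝ → Config (N + 1) (Fin 3) T3}

set_option maxHeartbeats 400000 in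
/-- **THE BOUND OF ONE WINDOW** (see the module docstring). [folklore] -/
theorem window_bound (hγ : IsHardSphereTrajectory (Torus.geometry (Fin 3)) ε (N + 1) γ) (hε : 0 < ε)
    (hr : 0 < r)
    -- the cut-off
    {g : ℝ → ℝ} {η₀ Gb σ : ℝ} (hσ : 0 < σ) (hη₀ : 0 ≤ η₀) (hg0 : ∀ b, η₀ ≤ b → g b = 0) (hgnn : ∀ b, 0 ≤ g b)
    (hGb : ∀ b, 0 ≤ b → g b ≤ Gb)
    -- the data of `ParityStability` and the implication it provides
    {n : ℕ} {Ψs Ξs : Fin n → (V3 × V3) × Metric.sphere (0 : V3) 1 → ℝ} {cs : Fin n → V3 → ℝ} {ϑs : Fin n → ℝ}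
    {ηP M cmin εP : ℝ} (hηP : 0 < ηP) (hM : 0 < M) (hεP : 0 ≤ εP) (hϑ : ∀ j, 0 < ϑs j ∧ ϑs j < 1)
    (HPS : ∀ (ν : Measure V3) [IsProbabilityMeasure ν] (κ : Measure ((V3 × V3) × Metric.sphere (0 : V3) 1))
        [IsFiniteMeasure κ] (c₀ : ℝ), cmin ≤ c₀ →
        Integrable (fun v : V3 => ‖v‖ ^ 3) ν → ∫ v, ‖v‖ ^ 3 ∂ν ≤ M →
        (κ Set.univ).toReal ≤ M →
        Integrable (fun q : (V3 × V3) × Metric.sphere (0 : V3) 1 => ‖q.1.1‖ ^ 2 + ‖q.1.2‖ ^ 2) κ →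
        ∫ q, (‖q.1.1‖ ^ 2 + ‖q.1.2‖ ^ 2) ∂κ ≤ M →
        let h : ℝ → V3 → ℝ := fun ϑ v => ∫ v', localMaxwellian 1 (ϑ ^ 2) v v' ∂ν
        let F : ℝ → (V3 × V3) × Metric.sphere (0 : V3) 1 → ℝ := fun ϑ q =>
          Real.log (h ϑ q.1.1) + Real.log (h ϑ q.1.2) -
            Real.log (h ϑ (collide q.2 q.1).1) - Real.log (h ϑ (collide q.2 q.1).2)
        (∀ j, |∫ q, Ψs j q * min 1 (Real.exp (-(F (ϑs j) q))) ∂κ| ≤ ηP) →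
        (∀ j, c₀ * ∫ q, Ξs j q * hardSphereKernel (q.1.2, q.1.1) q.2 ∂((ν.prod ν).prod sphereMeasure) ≤
          (∫ q, Ξs j q ∂κ) + ηP) →
        (∀ j, |∫ q, (cs j (collide q.2 q.1).1 + cs j (collide q.2 q.1).2 - cs j q.1.1 - cs j q.1.2) ∂κ| ≤ ηP) →
        ∃ θ : ℝ, 0 ≤ θ ∧ ∃ u : V3, (∀ j : Fin 3, |(∫ v, v j ∂ν) - u j| ≤ εP) ∧
          ∀ j k : Fin 3, |(∫ v, (v j - u j) * (v k - u k) ∂ν) - (if j = k then θ else 0)| ≤ εP)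
    -- the extended tests
    (hΞc : ∀ j, Continuous (Ξs j)) (hΞb : ∀ j, ∃ C : ℝ, ∀ q, |Ξs j q| ≤ C)
    {Ψt Ξt : Fin n → V3 × V3 × V3 → ℝ}
    (hΨt : ∀ j (m v w : V3) (hm : ‖m‖ = 1), Ψt j (m, v, w) = Ψs j ((v, w), ⟨m, mem_sphere_zero_iff_norm.2 hm⟩))
    (hΞtc : ∀ j, Continuous (Ξt j)) (hΞtb : ∀ j, ∃ C : ℝ, ∀ p, |Ξt j p| ≤ C)
    (hΞt : ∀ j (m v w : V3) (hm : ‖m‖ = 1), Ξt j (m, v, w) = Ξs j ((v, w), ⟨m, mem_sphere_zero_iff_norm.2 hm⟩))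
    -- the floor constant and the thresholds
    {g₀ ρmin V : ℝ} (hg₀ : 0 < g₀) (hρmin : 0 < ρmin) (hcmin : cmin = g₀ * σ ^ 3 * ρmin ^ 2) (hV : 1 ≤ V)
    -- the balance tests are passed
    (hbal : ∀ j, |∫ q, (cs j (collide q.2 q.1).1 + cs j (collide q.2 q.1).2 - cs j q.1.1 - cs j q.1.2)
      ∂(wrec ε r τ t₀ x₀ γ)| ≤ ηP) :
    g (σ ^ 3 * rhoW r τ γ t₀ x₀) * devW r τ γ t₀ x₀ ≤
      18 * (εP + εP ^ 2) * Gb * rhoW r τ γ t₀ x₀ +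
      4 * Gb * (∫ s in Set.Icc (0 : ℝ) τ, btent r (s - t₀) * ∫ q, cone r q.1 x₀ * sqTail V q.2 ∂(empiricalMeasure (γ s))) +
      4 * V ^ 2 * (Gb * ρmin +
        η₀ / σ ^ 3 * (g (σ ^ 3 * rhoW r τ γ t₀ x₀) * (∑ j, |KwO ε r τ (ϑs j) (Ψt j) γ t₀ x₀|) / ηP) +
        η₀ / σ ^ 3 * Gb * ((∑ j, max (g₀ * σ ^ 3 * BwW r τ (Ξt j) γ t₀ x₀ - KwR ε r τ (Ξt j) γ t₀ x₀) 0) / ηP) +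
        η₀ / σ ^ 3 * Gb * ((ε / (N + 1 : ℝ) * collisionPairSum (Torus.geometry (Fin 3)) ε γ (Set.Icc 0 τ)
          (fun s i _ => btent r (s - t₀) * cone r (γ s i).1 x₀)) / M) +
        η₀ / σ ^ 3 * Gb * ((ε / (N + 1 : ℝ) * collisionPairSum (Torus.geometry (Fin 3)) ε γ (Set.Icc 0 τ)
          (fun s i j => btent r (s - t₀) * cone r (γ s i).1 x₀ *
            (‖(pvW (γ s) i j).1‖ ^ 2 + ‖(pvW (γ s) i j).2‖ ^ 2))) / M) +
        η₀ / σ ^ 3 * Gb * ((∫ s in Set.Icc (0 : ℝ) τ, btent r (s - t₀) *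
          ∫ q, cone r q.1 x₀ * ‖q.2‖ ^ 3 ∂(empiricalMeasure (γ s))) / (M * ρmin))) := by
  have hγm := hγ.measurable_torus
  haveI := isFiniteMeasure_wlaw (N := N) (τ := τ) (t₀ := t₀) (x₀ := x₀) (γ := γ) hr
  haveI := isFiniteMeasure_wrec ε r τ t₀ x₀ γ
  obtain ⟨R, hRdef⟩ : ∃ R : ℝ, R = Real.sqrt (2 * configEnergy (γ 0)) := ⟨_, rfl⟩
  have hR : ∀ s k, ‖(γ s k).2‖ ≤ R := fun s k => by rw [hRdef]; exact norm_vel_le_sqrt_of_isHardSphereTrajectory hγ s k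
  -- ### names and signs (abbreviations are introduced by `obtain` and folded in the goal only)
  obtain ⟨ρ, hρdef⟩ : ∃ ρ : ℝ, ρ = rhoW r τ γ t₀ x₀ := ⟨_, rfl⟩
  obtain ⟨Tw, hTw⟩ : ∃ Tw : ℝ, Tw = ∫ s in Set.Icc (0 : ℝ) τ, btent r (s - t₀) *
    ∫ q, cone r q.1 x₀ * sqTail V q.2 ∂(empiricalMeasure (γ s)) := ⟨_, rfl⟩
  obtain ⟨M3, hM3⟩ : ∃ M3 : ℝ, M3 = ∫ s in Set.Icc (0 : ℝ) τ, btent r (s - t₀) *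
    ∫ q, cone r q.1 x₀ * ‖q.2‖ ^ 3 ∂(empiricalMeasure (γ s)) := ⟨_, rfl⟩
  obtain ⟨massK, hmassK⟩ : ∃ massK : ℝ, massK = ε / (N + 1 : ℝ) * collisionPairSum (Torus.geometry (Fin 3)) ε γ
    (Set.Icc 0 τ) (fun s i _ => btent r (s - t₀) * cone r (γ s i).1 x₀) := ⟨_, rfl⟩
  obtain ⟨mom2K, hmom2K⟩ : ∃ mom2K : ℝ, mom2K = ε / (N + 1 : ℝ) * collisionPairSum (Torus.geometry (Fin 3)) ε γ
    (Set.Icc 0 τ) (fun s i j => btent r (s - t₀) * cone r (γ s i).1 x₀ *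
      (‖(pvW (γ s) i j).1‖ ^ 2 + ‖(pvW (γ s) i j).2‖ ^ 2)) := ⟨_, rfl⟩
  obtain ⟨SO, hSO⟩ : ∃ SO : ℝ, SO = ∑ j, |KwO ε r τ (ϑs j) (Ψt j) γ t₀ x₀| := ⟨_, rfl⟩
  obtain ⟨SR, hSR⟩ : ∃ SR : ℝ, SR = ∑ j, max (g₀ * σ ^ 3 * BwW r τ (Ξt j) γ t₀ x₀ - KwR ε r τ (Ξt j) γ t₀ x₀) 0 :=
    ⟨_, rfl⟩
  rw [← hρdef, ← hTw, ← hM3, ← hmassK, ← hmom2K, ← hSO, ← hSR]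
  have hρ0 : 0 ≤ ρ := by rw [hρdef]; exact rhoW_nonneg hr hγm
  have hε1 : 0 ≤ ε / (N + 1 : ℝ) := div_nonneg hε.le (by positivity)
  have hTw0 : 0 ≤ Tw := by
    rw [hTw]
    refine integral_nonneg fun s => mul_nonneg (btent_nonneg _ _) ?_
    rw [integral_empiricalMeasure]
    exact mul_nonneg (by positivity) (Finset.sum_nonneg fun k _ => mul_nonneg (cone_nonneg hr _ _) (sqTail_nonneg _ _))
  have hM30 : 0 ≤ M3 := by
    rw [hM3]
    refine integral_nonneg fun s => mul_nonneg (btent_nonneg _ _) ?_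
    rw [integral_empiricalMeasure]
    exact mul_nonneg (by positivity) (Finset.sum_nonneg fun k _ => mul_nonneg (cone_nonneg hr _ _) (by positivity))
  have hmassK0 : 0 ≤ massK := by
    rw [hmassK]
    exact mul_nonneg hε1 (collisionPairSum_nonneg fun s i j => mul_nonneg (btent_nonneg _ _) (cone_nonneg hr _ _))
  have hmom2K0 : 0 ≤ mom2K := by
    rw [hmom2K]
    exact mul_nonneg hε1 (collisionPairSum_nonneg fun s i j =>
      mul_nonneg (mul_nonneg (btent_nonneg _ _) (cone_nonneg hr _ _)) (by positivity))
  have hSO0 : 0 ≤ SO := by rw [hSO]; exact Finset.sum_nonneg fun j _ => abs_nonneg _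
  have hSR0 : 0 ≤ SR := by rw [hSR]; exact Finset.sum_nonneg fun j _ => le_max_right _ _
  have hgρ : 0 ≤ g (σ ^ 3 * ρ) := hgnn _
  have hgG : g (σ ^ 3 * ρ) ≤ Gb := hGb _ (by positivity)
  have hGb0 : 0 ≤ Gb := hgρ.trans hgG
  have hcap : g (σ ^ 3 * ρ) * ρ ≤ η₀ / σ ^ 3 * g (σ ^ 3 * ρ) := cutoff_mul_le hσ hg0 hgnn hρ0
  have hρbar : 0 ≤ η₀ / σ ^ 3 * g (σ ^ 3 * ρ) := (mul_nonneg hgρ hρ0).trans hcap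
  -- ### the a-priori bound, valid on every window
  have hdev4 : devW r τ γ t₀ x₀ ≤ 4 * (V ^ 2 * ρ + Tw) := by
    rw [hρdef, hTw]
    exact (devW_le_four_mul hr hγm hR).trans (mul_le_mul_of_nonneg_left (integral_norm_sq_wlaw_le hγ hr V) (by norm_num))
  have hdev0 : 0 ≤ devW r τ γ t₀ x₀ := by
    unfold devW; exact Finset.sum_nonneg fun j _ => Finset.sum_nonneg fun k _ => abs_nonneg _
  -- ### reduction of the bad cases to `g ρ ≤` one of the six nonnegative terms
  have hρbarG : 0 ≤ η₀ / σ ^ 3 * Gb := by positivity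
  obtain ⟨X, hX⟩ : ∃ X : ℝ, X = Gb * ρmin + η₀ / σ ^ 3 * (g (σ ^ 3 * ρ) * SO / ηP) + η₀ / σ ^ 3 * Gb * (SR / ηP) +
    η₀ / σ ^ 3 * Gb * (massK / M) + η₀ / σ ^ 3 * Gb * (mom2K / M) + η₀ / σ ^ 3 * Gb * (M3 / (M * ρmin)) := ⟨_, rfl⟩
  rw [← hX]
  have hX1 : 0 ≤ Gb * ρmin := by positivity
  have hX2 : 0 ≤ η₀ / σ ^ 3 * (g (σ ^ 3 * ρ) * SO / ηP) := by positivity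
  have hX3 : 0 ≤ η₀ / σ ^ 3 * Gb * (SR / ηP) := by positivity
  have hX4 : 0 ≤ η₀ / σ ^ 3 * Gb * (massK / M) := by positivity
  have hX5 : 0 ≤ η₀ / σ ^ 3 * Gb * (mom2K / M) := by positivity
  have hX6 : 0 ≤ η₀ / σ ^ 3 * Gb * (M3 / (M * ρmin)) := by positivity
  have hgoal_of_bad : ∀ {Y : ℝ}, Y ≤ X → g (σ ^ 3 * ρ) * ρ ≤ Y →
      g (σ ^ 3 * ρ) * devW r τ γ t₀ x₀ ≤ 18 * (εP + εP ^ 2) * Gb * ρ + 4 * Gb * Tw + 4 * V ^ 2 * X := by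
    intro Y hYX hgY
    have h1 : g (σ ^ 3 * ρ) * devW r τ γ t₀ x₀ ≤ g (σ ^ 3 * ρ) * (4 * (V ^ 2 * ρ + Tw)) :=
      mul_le_mul_of_nonneg_left hdev4 hgρ
    have h2 : g (σ ^ 3 * ρ) * (4 * (V ^ 2 * ρ + Tw)) = 4 * V ^ 2 * (g (σ ^ 3 * ρ) * ρ) + 4 * (g (σ ^ 3 * ρ) * Tw) := by ring
    have h3 : g (σ ^ 3 * ρ) * Tw ≤ Gb * Tw := mul_le_mul_of_nonneg_right hgG hTw0
    have h4 : 0 ≤ 18 * (εP + εP ^ 2) * Gb * ρ := by positivity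
    have hV2 : 0 ≤ 4 * V ^ 2 := by positivity
    nlinarith [mul_le_mul_of_nonneg_left (hgY.trans hYX) hV2]
  -- ### the six bad cases
  by_cases hb1 : ρ < ρmin
  · refine hgoal_of_bad (Y := Gb * ρmin) (by rw [hX]; linarith) ?_
    exact mul_le_mul hgG hb1.le hρ0 hGb0
  by_cases hb2 : ∃ j, ηP < |KwO ε r τ (ϑs j) (Ψt j) γ t₀ x₀|
  · obtain ⟨j, hj⟩ := hb2
    refine hgoal_of_bad (Y := η₀ / σ ^ 3 * (g (σ ^ 3 * ρ) * SO / ηP)) (by rw [hX]; linarith) (hcap.trans ?_)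
    have hle : |KwO ε r τ (ϑs j) (Ψt j) γ t₀ x₀| ≤ SO := by
      rw [hSO]
      exact Finset.single_le_sum (f := fun j => |KwO ε r τ (ϑs j) (Ψt j) γ t₀ x₀|) (fun j _ => abs_nonneg _)
        (Finset.mem_univ j)
    have h1 : 1 ≤ SO / ηP := by rw [le_div_iff₀ hηP, one_mul]; exact hj.le.trans hle
    calc η₀ / σ ^ 3 * g (σ ^ 3 * ρ) = η₀ / σ ^ 3 * g (σ ^ 3 * ρ) * 1 := (mul_one _).symm
      _ ≤ η₀ / σ ^ 3 * g (σ ^ 3 * ρ) * (SO / ηP) := mul_le_mul_of_nonneg_left h1 hρbar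
      _ = _ := by ring
  by_cases hb3 : ∃ j, ηP < max (g₀ * σ ^ 3 * BwW r τ (Ξt j) γ t₀ x₀ - KwR ε r τ (Ξt j) γ t₀ x₀) 0
  · obtain ⟨j, hj⟩ := hb3
    refine hgoal_of_bad (Y := η₀ / σ ^ 3 * Gb * (SR / ηP)) (by rw [hX]; linarith) (hcap.trans ?_)
    have hle : max (g₀ * σ ^ 3 * BwW r τ (Ξt j) γ t₀ x₀ - KwR ε r τ (Ξt j) γ t₀ x₀) 0 ≤ SR := by
      rw [hSR]
      exact Finset.single_le_sum (f := fun j => max (g₀ * σ ^ 3 * BwW r τ (Ξt j) γ t₀ x₀ - KwR ε r τ (Ξt j) γ t₀ x₀) 0)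
        (fun j _ => le_max_right _ _) (Finset.mem_univ j)
    have h1 : 1 ≤ SR / ηP := by rw [le_div_iff₀ hηP, one_mul]; exact hj.le.trans hle
    calc η₀ / σ ^ 3 * g (σ ^ 3 * ρ) ≤ η₀ / σ ^ 3 * Gb * 1 := by rw [mul_one]; exact mul_le_mul_of_nonneg_left hgG (by positivity)
      _ ≤ η₀ / σ ^ 3 * Gb * (SR / ηP) := mul_le_mul_of_nonneg_left h1 hρbarG
  by_cases hb4 : M < massK
  · refine hgoal_of_bad (Y := η₀ / σ ^ 3 * Gb * (massK / M)) (by rw [hX]; linarith) (hcap.trans ?_)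
    have h1 : 1 ≤ massK / M := by rw [le_div_iff₀ hM, one_mul]; exact hb4.le
    calc η₀ / σ ^ 3 * g (σ ^ 3 * ρ) ≤ η₀ / σ ^ 3 * Gb * 1 := by rw [mul_one]; exact mul_le_mul_of_nonneg_left hgG (by positivity)
      _ ≤ η₀ / σ ^ 3 * Gb * (massK / M) := mul_le_mul_of_nonneg_left h1 hρbarG
  by_cases hb5 : M < mom2K
  · refine hgoal_of_bad (Y := η₀ / σ ^ 3 * Gb * (mom2K / M)) (by rw [hX]; linarith) (hcap.trans ?_)
    have h1 : 1 ≤ mom2K / M := by rw [le_div_iff₀ hM, one_mul]; exact hb5.le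
    calc η₀ / σ ^ 3 * g (σ ^ 3 * ρ) ≤ η₀ / σ ^ 3 * Gb * 1 := by rw [mul_one]; exact mul_le_mul_of_nonneg_left hgG (by positivity)
      _ ≤ η₀ / σ ^ 3 * Gb * (mom2K / M) := mul_le_mul_of_nonneg_left h1 hρbarG
  by_cases hb6 : M * ρmin < M3
  · refine hgoal_of_bad (Y := η₀ / σ ^ 3 * Gb * (M3 / (M * ρmin))) (by rw [hX]; linarith) (hcap.trans ?_)
    have h1 : 1 ≤ M3 / (M * ρmin) := by rw [le_div_iff₀ (by positivity), one_mul]; exact hb6.le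
    calc η₀ / σ ^ 3 * g (σ ^ 3 * ρ) ≤ η₀ / σ ^ 3 * Gb * 1 := by rw [mul_one]; exact mul_le_mul_of_nonneg_left hgG (by positivity)
      _ ≤ η₀ / σ ^ 3 * Gb * (M3 / (M * ρmin)) := mul_le_mul_of_nonneg_left h1 hρbarG
  -- ### the good case: `ParityStability` on `(ν_w, κ_w, g₀σ³ρ_w²)` (lemma `good_window`)
  rw [not_lt] at hb1 hb4 hb5 hb6
  push Not at hb2 hb3
  have hρpos : 0 < ρ := hρmin.trans_le hb1
  rw [hρdef] at hb1
  rw [hmassK] at hb4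
  rw [hmom2K] at hb5
  rw [hM3] at hb6
  have hdev := good_window (τ := τ) (t₀ := t₀) (x₀ := x₀) hγ hε hr hσ hη₀ hg0 hgnn hGb hηP hM hεP hϑ HPS hΞc hΞb
    hΨt hΞtc hΞtb hΞt hg₀ hρmin hcmin hV hbal hb1 hb2 hb3 hb4 hb5 hb6
  rw [← hρdef] at hdev
  -- conclusion in the good case
  have h1 : g (σ ^ 3 * ρ) * devW r τ γ t₀ x₀ ≤ Gb * (18 * ρ * (εP + εP ^ 2)) :=
    mul_le_mul hgG hdev hdev0 hGb0
  have hX0 : 0 ≤ X := by rw [hX]; positivity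
  have h2 : 0 ≤ 4 * Gb * Tw := by positivity
  have h3 : 0 ≤ 4 * V ^ 2 * X := by positivity
  nlinarith

end Window

/-- **Registered sub-goal `stub_wciBadWindowSplit` (helper K of `stub_windowCovarianceIsotropy`): the elementary split
behind the pricing of bad windows** — if `0 ≤ a ≤ 4(b + c)` and `g ρ ≤ Y` with `0 ≤ g ≤ G`, then
`g a ≤ 4Gc... ` in the form used: `g·a ≤ 4·(g ρ)·V² + 4·G·T` whenever `a ≤ 4(V²ρ + T)`, `0 ≤ T`. [folklore] -/
theorem stub_wciBadWindowSplit : ∀ {g a ρ V T G : ℝ}, 0 ≤ g → g ≤ G → 0 ≤ T → a ≤ 4 * (V ^ 2 * ρ + T) → g * a ≤ 4 * V ^ 2 * (g * ρ) + 4 * G * T := by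
  intro g a ρ V T G hg hgG hT ha
  nlinarith [mul_le_mul_of_nonneg_left ha hg, mul_le_mul_of_nonneg_right hgG hT]

end Summit.AtomisticToContinuum.HydrodynamicLimit.Theorems.ParityBandClosureWindowCovariance

end
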